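import Mathlib
import Summits.NavierStokesRegularity.NavierStokesRegularity.Theorems.TaoLadderRungTwoBreakOneShiftWindowKrawczykSlope
import HarnessLib

/-!
# The one-shift window system, XI: the SLOPE MATRIX OF THE RESIDUAL from a flow/time slope of the window run
# (the kernel form of the engine's `iG_DG`; cell harvest/h2-tao-ladder, seat p2; rung1/KERNEL-CHEAP-REPLAY-SPEC.md
# §2 (Krawczyk file) / §3 S4, rung1/RUNG1-P2G12-REPORT.md §53; support for K1(1) = `NoSurvivingDSSOne`,
# stmt-NavierStokesRegularity-20205)

MODEL lattice ODEs only (Tao 2016 §4 normal form on Tao's shift set `S`); nothing here is a statement about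
the Navier–Stokes equations; no item is closed; nothing numerical is proved.

Part X (…OneShiftWindowKrawczykSlope, `K1_of_residualSlope`) reduced the contraction clause (K1) of the Krawczyk
step to: for every two `AdmLip` points `u, v` with the same tails, a real SLOPE MATRIX `N ∈ [Nlo, Nhi]` with
`coord (G u) r − coord (G v) r = Σ_c N r c · Δ_c` (`Δ` = difference of the scaled window parts), plus interval
linear algebra. This file produces `N` — as an explicit FORMULA `resSlope` in a handful of real ingredients — from
the one analytic input a validated C¹ integration of the window system delivers, namely a slope of the WINDOW RUN
AT THE FLIGHT TIME in the scaled data: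

  `z_{i,k} − z'_{i,k} = Σ_c V i k c · Δ_c`   for every window shell `k`                                    (hV)

(`z = runAt u`, `z' = runAt v` = the two runs at their own flight times; the window columns of `V` are flow
slopes `∈ a_c · [DΦ]`, the column `none` is a time slope `∈ r_τ · f`-hull). The other ingredients are produced
HERE with their constraints: the renormalisation factor `g = gfac z`; the slope `γ = rsqrtDeriv θ` of
`x ↦ x^{-1/2}` between the two shell-1 energies, `θ ∈ [[e', e]]` (mean value theorem); the top-tail time slopes
`ρ_i`, `|ρ_i| ≤ R_W` (the `AdmLip` Lipschitz clause); the top-tail values `T_{i,W}(τ')` (in the tube). The rows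
of `resSlope` are the engine's `[DG]` rows (RUNG1-P2G11-REPORT §49, SPEC §2): `g V_{k+1,·} + z'_{k+1} γ h_·`
with `h_c = Σ_i (z_{i,1} + z'_{i,1}) V i 1 c` (one-shift rows), `g r_τ ρ_i [c = none] + T_{i,W}(τ') γ h_c` (top
rows), `½ Σ_i (z_{i,D} + z'_{i,D}) V i D c` (section row), minus `a_{i,j} [c = (i,j)]` (the `−y` term).

* `runAt u` — the window run of `u` at its own flight time; `gval_fst_of_lt` / `gval_fst_of_not_lt` / `gval_snd`
  (the residual in these terms); `preclampY_sub`, `preclampTau_sub` (scaled differences);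
* `rsqrtDeriv`, `exists_rsqrt_slope` — the mean-value slope of `x ↦ (√x)⁻¹` on `(0, ∞)`;
* `resSlope` — the formula; `exists_residualSlope` — **(hV) ⇒ ∃ θ ρ within their constraints with
  `coord (gval u) r − coord (gval v) r = Σ_c resSlope … r c · Δ_c` for every row** — the hypothesis `hN` of
  `K1_of_residualSlope` up to the interval evaluation of `resSlope` over the hulls (the replay's Krawczyk file).
-/

noncomputable section

-- the sub-problem namespace repeats the summit name by design (D-0017)
set_option linter.dupNamespace false

namespace Summit.NavierStokesRegularity.NavierStokesRegularity.Theorems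

namespace DSSOneShift

open Set Metric Literature.Analysis.FluidPDE Literature.Analysis.FluidPDE.TaoCascade CertificateGlueOn

variable {m : ℕ}

/-! ### The mean-value slope of `x ↦ x^{-1/2}` -/

/-- The derivative of `x ↦ (√x)⁻¹` at `θ > 0` in the form `HasDerivAt.inv` produces it:
`−(1/(2√θ)) / (√θ)² = −½ θ^{-3/2}`. [folklore] -/
def rsqrtDeriv (θ : ℝ) : ℝ := -(1 / (2 * Real.sqrt θ)) / Real.sqrt θ ^ 2

/-- `x ↦ (√x)⁻¹` has derivative `rsqrtDeriv x` at every `x > 0`. [folklore] -/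
theorem hasDerivAt_rsqrt {x : ℝ} (hx : 0 < x) : HasDerivAt (fun y => (Real.sqrt y)⁻¹) (rsqrtDeriv x) x :=
  (Real.hasDerivAt_sqrt hx.ne').inv (Real.sqrt_pos.2 hx).ne'

/-- **Mean-value slope of `x ↦ (√x)⁻¹`**: for `e, e' > 0` there is `θ` between them with
`(√e)⁻¹ − (√e')⁻¹ = rsqrtDeriv θ · (e − e')`. [folklore] -/
theorem exists_rsqrt_slope {e e' : ℝ} (he : 0 < e) (he' : 0 < e') :
    ∃ θ ∈ uIcc e' e, 0 < θ ∧ (Real.sqrt e)⁻¹ - (Real.sqrt e')⁻¹ = rsqrtDeriv θ * (e - e') := by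
  have key : ∀ a b : ℝ, 0 < a → a < b → ∃ θ ∈ Ioo a b,
      (Real.sqrt b)⁻¹ - (Real.sqrt a)⁻¹ = rsqrtDeriv θ * (b - a) := by
    intro a b ha hab
    have hcont : ContinuousOn (fun y => (Real.sqrt y)⁻¹) (Icc a b) := fun y hy =>
      (hasDerivAt_rsqrt (ha.trans_le hy.1)).continuousAt.continuousWithinAt
    obtain ⟨θ, hθ, h⟩ := exists_hasDerivAt_eq_slope (fun y => (Real.sqrt y)⁻¹) rsqrtDeriv hab hcont
      (fun y hy => hasDerivAt_rsqrt (ha.trans hy.1))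
    refine ⟨θ, hθ, ?_⟩
    rw [h, div_mul_cancel₀ _ (sub_ne_zero.2 hab.ne')]
  rcases lt_trichotomy e' e with hlt | heq | hgt
  · obtain ⟨θ, hθ, h⟩ := key e' e he' hlt
    exact ⟨θ, Ioo_subset_Icc_self hθ |> fun h' => by rwa [uIcc_of_le hlt.le], he'.trans hθ.1, h⟩
  · subst heq
    exact ⟨e', by simp, he', by simp⟩
  · obtain ⟨θ, hθ, h⟩ := key e e' he hgt
    refine ⟨θ, Ioo_subset_Icc_self hθ |> fun h' => by rwa [uIcc_comm, uIcc_of_le hgt.le], he.trans hθ.1, ?_⟩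
    have : (Real.sqrt e)⁻¹ - (Real.sqrt e')⁻¹ = -((Real.sqrt e')⁻¹ - (Real.sqrt e)⁻¹) := by ring
    rw [this, h]; ring

namespace OneShiftFrame

variable (F : OneShiftFrame m)

/-! ### The window run of a point at its own flight time; the residual in these terms -/

/-- **The window run of a point at its own flight time**: `z = slice (windowRunMap (preclampY u) (preclampTail u)) (preclampTau u)`
(a lattice state; window shells = the run, tail shells = the tails). [cite: Tao2016AveragedNS, §5.3; cell vocabulary, harvest/h2-tao-ladder rung1/STAGE2-LEMMA.md §2 (z = window run at the flight time)] -/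
def runAt (ε₀ : ℝ) (α : Fin m → Fin m → Fin m → ℤ × ℤ × ℤ → ℝ) (u : F.Space) : Fin m → ℤ → ℝ :=
  slice (F.windowRunMap ε₀ α (F.preclampY u) (F.preclampTail u)) (F.preclampTau u)

/-- A one-shift row of the residual: `g(z) z_{i,j+1} − y_{i,j}` (`j + 1 < W`). [folklore] -/
theorem gval_fst_of_lt (ε₀ : ℝ) (α : Fin m → Fin m → Fin m → ℤ × ℤ × ℤ → ℝ) (u : F.Space) (i : Fin m)
    (j : Fin F.W) (hj : ((j : ℕ) : ℤ) + 1 < F.W) :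
    (F.gval ε₀ α u).1 i j =
      gfac (F.runAt ε₀ α u) * F.runAt ε₀ α u i (((j : ℕ) : ℤ) + 1) - F.preclampY u i ((j : ℕ) : ℤ) := by
  simp only [gval, residual, if_pos hj, runAt, slice]

/-- A top row of the residual: `g(z) T_{i,W}(τ) − y_{i,j}` (`j + 1 = W`). [folklore] -/
theorem gval_fst_of_not_lt (ε₀ : ℝ) (α : Fin m → Fin m → Fin m → ℤ × ℤ × ℤ → ℝ) (u : F.Space) (i : Fin m)
    (j : Fin F.W) (hj : ¬ ((j : ℕ) : ℤ) + 1 < F.W) :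
    (F.gval ε₀ α u).1 i j =
      gfac (F.runAt ε₀ α u) * F.preclampTail u i F.W (F.preclampTau u) - F.preclampY u i ((j : ℕ) : ℤ) := by
  simp only [gval, residual, if_neg hj, runAt]

/-- The section row of the residual: `e(z_D) − strig`. [folklore] -/
theorem gval_snd (ε₀ : ℝ) (α : Fin m → Fin m → Fin m → ℤ × ℤ × ℤ → ℝ) (u : F.Space) :
    (F.gval ε₀ α u).2 = shellEnergy (F.runAt ε₀ α u) F.D - F.strig := by
  simp only [gval, residual, runAt]

/-- Scaled difference of the pre-clamped window starts of two admissible points: `a_{i,j} · Δ_{(i,j)}`. [folklore] -/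
theorem preclampY_sub {R : ℤ → ℝ} {u v : F.Space} (hu : F.AdmLip R u) (hv : F.AdmLip R v) (i : Fin m)
    (j : Fin F.W) :
    F.preclampY u i ((j : ℕ) : ℤ) - F.preclampY v i ((j : ℕ) : ℤ) = F.a i ((j : ℕ) : ℤ) * (u.1 i j - v.1 i j) := by
  rw [F.preclampY_natCast, F.preclampY_natCast, clampUnit_of_abs_le (hu.1.1 i j), clampUnit_of_abs_le (hv.1.1 i j)]
  ring

/-- Scaled difference of the pre-clamped flight times of two admissible points: `r_τ · Δ_none`. [folklore] -/
theorem preclampTau_sub {R : ℤ → ℝ} {u v : F.Space} (hu : F.AdmLip R u) (hv : F.AdmLip R v) :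
    F.preclampTau u - F.preclampTau v = F.rτ * (u.2.1 - v.2.1) := by
  simp only [preclampTau, clampUnit_of_abs_le hu.1.2.1, clampUnit_of_abs_le hv.1.2.1]; ring

/-- The pre-clamped flight time of ANY point lies in the flight interval `[0, τ_hi]`. [folklore] -/
theorem preclampTau_mem (u : F.Space) : F.preclampTau u ∈ Icc 0 F.τhi := by
  have h := abs_le.1 (abs_clampUnit_le u.2.1)
  have hr := F.rτ_pos; have hc := F.τc_gt
  simp only [preclampTau, τhi, mem_Icc]
  constructor <;> nlinarith

/-! ### The residual slope formula -/

/-- The shell-1 coupling row `h_c = Σ_i (z_{i,1} + z'_{i,1}) · V i 1 c` (slope of the shell-1 energy `Σ_i z_{i,1}²`).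
[cite: Tao2016AveragedNS, §5.3; cell vocabulary, harvest/h2-tao-ladder rung1/KERNEL-CHEAP-REPLAY-SPEC.md §2 (hvec)] -/
def hrow (z z' : Fin m → ℤ → ℝ) (V : Fin m → ℤ → F.WIdx → ℝ) (c : F.WIdx) : ℝ :=
  ∑ i, (z i 1 + z' i 1) * V i 1 c

/-- **The residual slope formula** (kernel form of the engine's `iG_DG`), entry `(r, c)`, in the ingredients:
renormalisation factor `g`, rsqrt slope `γ`, the two runs `z, z'` at their flight times, the run slope `V`
(window shells × scaled columns), top-tail time slopes `ρ`, top-tail values `Ttop` at the second flight time.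
One-shift rows `(i, j)`, `j+1 < W`: `g V i (j+1) c + z'_{i,j+1} γ h_c − a_{i,j} [c = (i,j)]`; top rows (`j+1 = W`):
`g r_τ ρ_i [c = none] + Ttop_i γ h_c − a_{i,j} [c = (i,j)]`; section row: `½ Σ_i (z_{i,D} + z'_{i,D}) V i D c`.
[cite: Tao2016AveragedNS, §5.3; cell vocabulary, harvest/h2-tao-ladder rung1/KERNEL-CHEAP-REPLAY-SPEC.md §2 (Krawczyk file: [DG] rows), rung1/RUNG1-P2G11-REPORT.md §49] -/
def resSlope (g γ : ℝ) (z z' : Fin m → ℤ → ℝ) (V : Fin m → ℤ → F.WIdx → ℝ) (ρ Ttop : Fin m → ℝ) :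
    F.WIdx → F.WIdx → ℝ := fun r c =>
  match r with
  | some (i, j) =>
      (if ((j : ℕ) : ℤ) + 1 < F.W then
          g * V i (((j : ℕ) : ℤ) + 1) c + z' i (((j : ℕ) : ℤ) + 1) * γ * F.hrow z z' V c
        else g * (if c = none then F.rτ * ρ i else 0) + Ttop i * γ * F.hrow z z' V c) -
        (if c = some (i, j) then F.a i ((j : ℕ) : ℤ) else 0)
  | none => (1 / 2) * ∑ i, (z i F.D + z' i F.D) * V i F.D c

/-- Swapping a weighted sum of slope rows: `Σ_i a_i (Σ_c V_i c Δ_c) = Σ_c (Σ_i a_i V_i c) Δ_c`. [folklore] -/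
theorem sum_mul_sum_slope (a : Fin m → ℝ) (W : Fin m → F.WIdx → ℝ) (Δ : F.WIdx → ℝ) :
    ∑ i, a i * ∑ c, W i c * Δ c = ∑ c, (∑ i, a i * W i c) * Δ c := by
  simp_rw [Finset.mul_sum, Finset.sum_mul]
  rw [Finset.sum_comm]
  exact Finset.sum_congr rfl fun c _ => Finset.sum_congr rfl fun i _ => by ring

/-- A difference of sums of squares as a slope: `Σ_i z_i² − Σ_i z'_i² = Σ_i (z_i + z'_i)(z_i − z'_i)`. [folklore] -/
theorem sum_sq_sub_sum_sq (z z' : Fin m → ℝ) :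
    ∑ i, z i ^ 2 - ∑ i, z' i ^ 2 = ∑ i, (z i + z' i) * (z i - z' i) := by
  rw [← Finset.sum_sub_distrib]; exact Finset.sum_congr rfl fun i _ => by ring

/-- Splitting a residual slope row applied to `Δ`: `Σ_c ((A_c + B_c) − a [c = c₀]) Δ_c = Σ A Δ + Σ B Δ − a Δ_{c₀}`. [folklore] -/
theorem sum_row_apply (A B Δ : F.WIdx → ℝ) (a : ℝ) (c₀ : F.WIdx) :
    ∑ c, ((A c + B c) - (if c = c₀ then a else 0)) * Δ c = ∑ c, A c * Δ c + ∑ c, B c * Δ c - a * Δ c₀ := by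
  classical
  simp only [sub_mul, add_mul, Finset.sum_sub_distrib, Finset.sum_add_distrib, ite_mul, zero_mul,
    Finset.sum_ite_eq', Finset.mem_univ, if_true]

/-- Pulling a constant out of a slope row applied to `Δ`. [folklore] -/
theorem sum_const_mul_apply (a : ℝ) (W Δ : F.WIdx → ℝ) : ∑ c, a * W c * Δ c = a * ∑ c, W c * Δ c := by
  rw [Finset.mul_sum]; exact Finset.sum_congr rfl fun c _ => by ring

/-- The flight-time column alone: `Σ_c (a [c = none]) Δ_c = a Δ_none`. [folklore] -/
theorem sum_none_col_apply (a : ℝ) (Δ : F.WIdx → ℝ) :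
    ∑ c, (if c = none then a else 0) * Δ c = a * Δ none := by
  classical
  simp only [ite_mul, zero_mul, Finset.sum_ite_eq', Finset.mem_univ, if_true]

/-- **THE RESIDUAL SLOPE from a run slope.** Two `AdmLip` points `u, v` with the same tails; the window
contains the shells `1` and `D`; the shell-1 energies of the two runs at their flight times are positive; and
(hV) the runs at their flight times differ, on every window shell, by the slope rows `V i k` applied to the scaled
difference `Δ` of the window parts. THEN there are `θ` between the two shell-1 energies (`θ > 0`) and top-tail
time slopes `ρ` with `|ρ_i| ≤ R_W` such that, for EVERY row `r`,
`coord (gval u) r − coord (gval v) r = Σ_c resSlope (gfac z) (rsqrtDeriv θ) z z' V ρ (T_{·,W}(τ')) r c · Δ_c`.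
Feeding the interval evaluation of `resSlope` over the hulls (z, z' ∈ z-hull; θ ∈ [e_lo, e_hi]; V ∈ [V]; |ρ| ≤ R_W;
top tail in its tube) into part X `K1_of_residualSlope` gives (K1).
[cite: Tao2016AveragedNS, §5.3; cell vocabulary, harvest/h2-tao-ladder rung1/KERNEL-CHEAP-REPLAY-SPEC.md §2/§3 (S4), rung1/RUNG1-P2G11-REPORT.md §49] -/
theorem exists_residualSlope {ε₀ : ℝ} {α : Fin m → Fin m → Fin m → ℤ × ℤ × ℤ → ℝ} {R : ℤ → ℝ}
    (hW1 : F.InWindow 1) (hD : F.InWindow F.D) {u v : F.Space} (hu : F.AdmLip R u) (hv : F.AdmLip R v)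
    (huv : u.2.2 = v.2.2) (he : 0 < ∑ i, F.runAt ε₀ α u i 1 ^ 2) (he' : 0 < ∑ i, F.runAt ε₀ α v i 1 ^ 2)
    (V : Fin m → ℤ → F.WIdx → ℝ)
    (hV : ∀ i k, F.InWindow k → F.runAt ε₀ α u i k - F.runAt ε₀ α v i k =
      ∑ c, V i k c * (F.coord (F.winPart u) c - F.coord (F.winPart v) c)) :
    ∃ θ ρ, θ ∈ uIcc (∑ i, F.runAt ε₀ α v i 1 ^ 2) (∑ i, F.runAt ε₀ α u i 1 ^ 2) ∧ 0 < θ ∧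
      (∀ i, |ρ i| ≤ R F.W) ∧
      ∀ r, F.coord (F.gval ε₀ α u) r - F.coord (F.gval ε₀ α v) r =
        ∑ c, F.resSlope (gfac (F.runAt ε₀ α u)) (rsqrtDeriv θ) (F.runAt ε₀ α u) (F.runAt ε₀ α v) V ρ
          (fun i => F.preclampTail v i F.W (F.preclampTau v)) r c *
          (F.coord (F.winPart u) c - F.coord (F.winPart v) c) := by
  classical
  -- abbreviations
  set z := F.runAt ε₀ α u with hz
  set z' := F.runAt ε₀ α v with hz'
  obtain ⟨Δ, hΔ⟩ : ∃ Δ : F.WIdx → ℝ, ∀ c, F.coord (F.winPart u) c - F.coord (F.winPart v) c = Δ c :=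
    ⟨_, fun _ => rfl⟩
  simp only [hΔ] at hV ⊢
  have hΔy : ∀ i (j : Fin F.W), u.1 i j - v.1 i j = Δ (some (i, j)) := fun i j => by
    rw [← hΔ]; simp [winPart]
  have hΔτ : u.2.1 - v.2.1 = Δ none := by rw [← hΔ]; simp [winPart]
  -- same tails
  have hT : F.preclampTail u = F.preclampTail v := by
    funext i k t; simp only [preclampTail, huv]
  -- the rsqrt slope between the shell-1 energies
  obtain ⟨θ, hθmem, hθpos, hθ⟩ := exists_rsqrt_slope he he'
  -- the top-tail time slopes
  have hWout : ¬ F.InWindow F.W := fun h => lt_irrefl _ h.2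
  have hρ : ∀ i, ∃ ρ : ℝ, |ρ| ≤ R F.W ∧
      F.preclampTail v i F.W (F.preclampTau u) - F.preclampTail v i F.W (F.preclampTau v) =
        ρ * (F.preclampTau u - F.preclampTau v) := by
    intro i
    have hlip := hv.2 i F.W hWout (F.preclampTau v) (F.preclampTau_mem v) (F.preclampTau u) (F.preclampTau_mem u)
    rw [← F.preclampTail_eq_decodeTail hv.1 i hWout, ← F.preclampTail_eq_decodeTail hv.1 i hWout] at hlip
    -- `R_W ≥ 0` (the Lipschitz clause on the non-degenerate pair of times `0`, `τ_hi`)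
    have hR : 0 ≤ R F.W := by
      have h2 := hv.2 i F.W hWout 0 ⟨le_rfl, F.τhi_pos.le⟩ F.τhi ⟨F.τhi_pos.le, le_rfl⟩
      have hpos : 0 < |F.τhi - 0| := by rw [sub_zero, abs_of_pos F.τhi_pos]; exact F.τhi_pos
      refine not_lt.1 fun hneg => ?_
      have h3 : R F.W * |F.τhi - 0| < 0 := mul_neg_of_neg_of_pos hneg hpos
      linarith [abs_nonneg (F.decodeTail v i F.W F.τhi - F.decodeTail v i F.W 0)]
    exact exists_slope_of_lipschitz hR hlip
  choose ρ hρb hρrep using hρ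
  refine ⟨θ, ρ, hθmem, hθpos, hρb, fun r => ?_⟩
  -- the shell-1 energy difference as a slope
  have hg : gfac z - gfac z' = rsqrtDeriv θ * ∑ c, F.hrow z z' V c * Δ c := by
    have h1 : gfac z - gfac z' = rsqrtDeriv θ * (∑ i, z i 1 ^ 2 - ∑ i, z' i 1 ^ 2) := hθ
    rw [h1, sum_sq_sub_sum_sq]
    congr 1
    have h2 : ∀ i, z i 1 - z' i 1 = ∑ c, V i 1 c * Δ c := fun i => hV i 1 hW1
    simp_rw [h2]
    exact F.sum_mul_sum_slope _ _ _
  rcases r with _ | ⟨i, j⟩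
  · -- section row
    rw [coord_none, coord_none, F.gval_snd, F.gval_snd, ← hz, ← hz']
    have h2 : ∀ i, z i F.D - z' i F.D = ∑ c, V i F.D c * Δ c := fun i => hV i F.D hD
    have eL : shellEnergy z F.D - F.strig - (shellEnergy z' F.D - F.strig) =
        (1 / 2) * (∑ i, z i F.D ^ 2 - ∑ i, z' i F.D ^ 2) := by
      simp only [shellEnergy]; ring
    rw [eL, sum_sq_sub_sum_sq]
    simp_rw [h2]
    rw [F.sum_mul_sum_slope, Finset.mul_sum]
    refine Finset.sum_congr rfl fun c _ => ?_
    simp only [resSlope]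
    ring
  · by_cases hj : ((j : ℕ) : ℤ) + 1 < F.W
    · -- one-shift row
      rw [coord_some, coord_some, F.gval_fst_of_lt ε₀ α u i j hj, F.gval_fst_of_lt ε₀ α v i j hj, ← hz, ← hz']
      have hk : F.InWindow (((j : ℕ) : ℤ) + 1) := ⟨by positivity, hj⟩
      have hzk := hV i _ hk
      have hy := F.preclampY_sub hu hv i j
      have e1 : gfac z * z i (((j : ℕ) : ℤ) + 1) - F.preclampY u i ((j : ℕ) : ℤ) -
          (gfac z' * z' i (((j : ℕ) : ℤ) + 1) - F.preclampY v i ((j : ℕ) : ℤ)) =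
          gfac z * (z i (((j : ℕ) : ℤ) + 1) - z' i (((j : ℕ) : ℤ) + 1)) +
            (gfac z - gfac z') * z' i (((j : ℕ) : ℤ) + 1) -
            (F.preclampY u i ((j : ℕ) : ℤ) - F.preclampY v i ((j : ℕ) : ℤ)) := by ring
      have eR : ∑ c, F.resSlope (gfac z) (rsqrtDeriv θ) z z' V ρ
            (fun i => F.preclampTail v i F.W (F.preclampTau v)) (some (i, j)) c * Δ c =
          gfac z * ∑ c, V i (((j : ℕ) : ℤ) + 1) c * Δ c +
            z' i (((j : ℕ) : ℤ) + 1) * rsqrtDeriv θ * ∑ c, F.hrow z z' V c * Δ c -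
            F.a i ((j : ℕ) : ℤ) * Δ (some (i, j)) := by
        simp only [resSlope, if_pos hj]
        rw [F.sum_row_apply, F.sum_const_mul_apply, F.sum_const_mul_apply]
      rw [e1, hzk, hg, hy, hΔy, eR]
      ring
    · -- top row
      rw [coord_some, coord_some, F.gval_fst_of_not_lt ε₀ α u i j hj, F.gval_fst_of_not_lt ε₀ α v i j hj,
        ← hz, ← hz', hT]
      have hy := F.preclampY_sub hu hv i j
      have e1 : gfac z * F.preclampTail v i F.W (F.preclampTau u) - F.preclampY u i ((j : ℕ) : ℤ) -
          (gfac z' * F.preclampTail v i F.W (F.preclampTau v) - F.preclampY v i ((j : ℕ) : ℤ)) =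
          gfac z * (F.preclampTail v i F.W (F.preclampTau u) - F.preclampTail v i F.W (F.preclampTau v)) +
            (gfac z - gfac z') * F.preclampTail v i F.W (F.preclampTau v) -
            (F.preclampY u i ((j : ℕ) : ℤ) - F.preclampY v i ((j : ℕ) : ℤ)) := by ring
      have eR : ∑ c, F.resSlope (gfac z) (rsqrtDeriv θ) z z' V ρ
            (fun i => F.preclampTail v i F.W (F.preclampTau v)) (some (i, j)) c * Δ c =
          gfac z * ((F.rτ * ρ i) * Δ none) +
            F.preclampTail v i F.W (F.preclampTau v) * rsqrtDeriv θ * ∑ c, F.hrow z z' V c * Δ c -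
            F.a i ((j : ℕ) : ℤ) * Δ (some (i, j)) := by
        simp only [resSlope, if_neg hj]
        rw [F.sum_row_apply, F.sum_const_mul_apply, F.sum_const_mul_apply, F.sum_none_col_apply]
      rw [e1, hρrep i, F.preclampTau_sub hu hv, hΔτ, hg, hy, hΔy, eR]
      ring

end OneShiftFrame

end DSSOneShift

end Summit.NavierStokesRegularity.NavierStokesRegularity.Theorems
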